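import Mathlib
import HarnessLib

/-!
# PiTranscendenceMeasure

Topic `Literature/NumberTheory/Transcendental`. Named literature fact(s) relocated by the gate from `Summits/Schanuel/Schanuel/Theorems/DiophantineDichotomyEPiSimultaneousTypePiFloor.lean`
(accept-time relocation of `[cite]`d propositions written inline in a Summits proposal; human ruling 2026-08-15).
Sources: NesterenkoWaldschmidt1996.

* `Literature.NumberTheory.Transcendental.NesterenkoWaldschmidt1996_thm_2_2`
-/

namespace Literature.NumberTheory.Transcendental

/-- **Nesterenko–Waldschmidt 1996, Theorem 2 (2)** (transcendence measure of `π`): "If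
`P ∈ ℤ[x]`, `P ≠ 0`, `deg P ≤ d`, `L(P) ≤ L`, and `L ≥ 3`, then
`|P(π)| ≥ exp{−2·10⁶ d (log L + d log d)(1 + log d)}`", `L(P) = Σ|aᵢ|` the length (ibid. p. 1).
Stated for natural `d ≥ 1`, `L ≥ 3`. NAMED FACT, not proved here; users take
`(h : NesterenkoWaldschmidt1996_thm_2_2)`.
[cite: NesterenkoWaldschmidt1996, Thm 2(2)] [file NumberTheory/Transcendental/PiTranscendenceMeasure] -/
def NesterenkoWaldschmidt1996_thm_2_2 : Prop :=
  ∀ (P : Polynomial ℤ) (d L : ℕ), P ≠ 0 → 1 ≤ d → P.natDegree ≤ d →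
    (∑ k ∈ Finset.range (P.natDegree + 1), |P.coeff k|) ≤ (L : ℤ) → 3 ≤ L →
    Real.exp (-(2 * 10 ^ 6 * (d : ℝ) * (Real.log L + d * Real.log d) * (1 + Real.log d))) ≤
      ‖Polynomial.aeval (Real.pi : ℂ) P‖

end Literature.NumberTheory.Transcendental
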